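import Mathlib
import HarnessLib
import Summits.Ventures.LatticeQCDFlow.Exactness.NCMCGeneralSpaceBarPairsEveryStart
import Summits.Ventures.LatticeQCDFlow.Exactness.NCMCGeneralSpaceWilsonHeatBathBar

/-!
# The engine's BAR lane between two Wilson couplings from EVERY pair of initial gauge fields

HONEST FRAMING: exact (Metropolis-corrected) sampling algorithms for lattice gauge theory;
figures of merit are autocorrelation/cost numbers at stated couplings and volumes; no
continuum-physics claim.

Venture `LatticeQCDFlow` (cell pub-lqcd), topic `Exactness`; FANOUT row 13 (`eng-snf`, GEN-18).
NEW WORK of the cell, not a published result; no definition is introduced; nothing is cited as a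
fact.  The engine instance of `NCMCGeneralSpaceBarPairsEveryStart.lean` with row 9's torus Wilson
heat-bath link sweeps as the two level samplers (`wilson_heatBathSweep_package`, GEN-16's
`NCMCGeneralSpaceWilsonHeatBathBar.lean`, whose `CrooksPair.tendsto_barRoot_ae_wilsonHeatBathRestartPairs`
is the same statement from the EQUILIBRIUM start `P_F ⊗ P_R`).

## Content

* **`CrooksPair.tendsto_barRoot_wilsonHeatBathRestartPairs_everyStart`** — torus Wilson theory
  (`G` compact second countable, `ρ` continuous, `L ≠ 0`), ANY Crooks pair from `wilsonWeight ρ β₀`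
  to `wilsonWeight ρ β₁` (`e^{−ΔF} = Z_{β₁}/Z_{β₀}`); forward evolutions launched off a heat-bath chain
  at `β₀`, reverse evolutions off an independent heat-bath chain at `β₁`, paired index by index; for
  EVERY pair of initial gauge fields `(U₀, V₀)` (first forward record launched from `U₀`, first
  reverse record from `V₀`): almost surely every sequence solving the sample Bennett equation for
  all large `n` converges to `ΔF`.

NOT CLAIMED: rates; anything numerical.
-/

namespace Summit.Ventures.LatticeQCDFlow.Exactness.GeneralNCMC

open MeasureTheory ProbabilityTheory Set Filter Finset
open scoped ENNReal Topology

section Wilson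

open Literature.MathematicalPhysics.QuantumFieldTheory

variable {d L N : ℕ} {G : Type*} [Group G] [TopologicalSpace G] [IsTopologicalGroup G]
  (ρ : G →* Matrix (Fin N) (Fin N) ℂ) [CompactSpace G] [MeasurableSpace G] [BorelSpace G]
  [SecondCountableTopology G]

/-- **THE BAR ENGINE INSTANCE FROM EVERY PAIR OF INITIAL GAUGE FIELDS.**  Torus Wilson theory,
compact second-countable `G`, continuous `ρ`, `L ≠ 0`; ANY Crooks pair from `wilsonWeight ρ β₀` to
`wilsonWeight ρ β₁` with `e^{−ΔF} = Z_{β₁}/Z_{β₀}`; heat-bath link sweeps at `β₀` / `β₁` over edge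
lists visiting every edge between launches on the two legs, run independently and paired index by
index.  For EVERY pair `(U₀, V₀)` of initial gauge fields: almost surely, every sequence solving the
sample Bennett equation for all large `n` converges to `ΔF`. -/
theorem CrooksPair.tendsto_barRoot_wilsonHeatBathRestartPairs_everyStart [NeZero L]
    (hρ : Continuous ρ) (β₀ β₁ : ℝ) {l₀ l₁ : List (Edge d L)} (hl₀ : ∀ ed, ed ∈ l₀)
    (hl₁ : ∀ ed, ed ∈ l₁) {E : Type*} [MeasurableSpace E] {κF κR : Kernel (GaugeConfig d L G) E}
    [IsMarkovKernel κF] [IsMarkovKernel κR] {s e : E → GaugeConfig d L G} {W : E → ℝ}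
    (h : CrooksPair (wilsonWeight (d := d) (L := L) ρ β₀) (wilsonWeight (d := d) (L := L) ρ β₁)
      κF κR s e W) {ΔF : ℝ}
    (hΔF : Real.exp (-ΔF) = (((wilsonWeight (d := d) (L := L) ρ β₀) univ)⁻¹ *
      (wilsonWeight (d := d) (L := L) ρ β₁) univ).toReal) :
    ∃ (_ : IsMarkovKernel (cycle (l₀.map (siteHeatBath (fun _ : Edge d L => haarProbability G)
        (gibbsDensity fun U : GaugeConfig d L G => β₀ * wilsonAction ρ U)))))
      (_ : IsMarkovKernel (cycle (l₁.map (siteHeatBath (fun _ : Edge d L => haarProbability G)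
        (gibbsDensity fun U : GaugeConfig d L G => β₁ * wilsonAction ρ U))))),
      ∀ U₀ V₀ : GaugeConfig d L G, ∀ᵐ x ∂(Kernel.trajMeasure (X := fun _ : ℕ => E × E)
          ((κF U₀).prod (κR V₀))
          (fun k : ℕ => ((((κF ∘ₖ cycle (l₀.map (siteHeatBath (fun _ : Edge d L => haarProbability G)
              (gibbsDensity fun U : GaugeConfig d L G => β₀ * wilsonAction ρ U)))).comap s
                h.measurable_s) ∥ₖ
            ((κR ∘ₖ cycle (l₁.map (siteHeatBath (fun _ : Edge d L => haarProbability G)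
              (gibbsDensity fun U : GaugeConfig d L G => β₁ * wilsonAction ρ U)))).comap e
                h.measurable_e))).comap
            (fun hh : (j : ↥(Finset.Iic k)) → E × E => hh ⟨k, Finset.mem_Iic.2 le_rfl⟩)
            (measurable_pi_apply _))),
        ∀ dseq : ℕ → ℝ,
          (∀ᶠ n : ℕ in atTop, (∑ i ∈ range n, Real.sigmoid (dseq n - W (x i).1)) -
            ∑ i ∈ range n, Real.sigmoid (W (x i).2 - dseq n) = 0) →
          Tendsto dseq atTop (𝓝 ΔF) := by
  obtain ⟨hMk₀, hfin₀, m₀, hmfin₀, h0, hm₀, hK₀, hmin₀⟩ := wilson_heatBathSweep_package ρ hρ β₀ hl₀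
  obtain ⟨hMk₁, hfin₁, m₁, hmfin₁, h1, hm₁, hK₁, hmin₁⟩ := wilson_heatBathSweep_package ρ hρ β₁ hl₁
  haveI := hMk₀
  haveI := hMk₁
  haveI := hfin₀
  haveI := hfin₁
  haveI := hmfin₀
  haveI := hmfin₁
  exact ⟨hMk₀, hMk₁, fun U₀ V₀ =>
    h.tendsto_barRoot_restartChains_everyStart _ _ h0 h1 hK₀ hK₁ hΔF hm₀ hm₁ hmin₀ hmin₁ U₀ V₀⟩

end Wilson

end Summit.Ventures.LatticeQCDFlow.Exactness.GeneralNCMC
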